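import Mathlib

/-!
# Route `FilamentSkeletonRss` · child crux `TangentSkeletonNearStraightL` (stmt-NavierStokesRegularity-23320) · registered line
# `child_tangent_analytic_strip_L` (b0b56c52900dd90a), stub `stub_stripPropagation` — brick: THE INTEGRABLE MAJORANT OF THE UNSHIFTED SOURCES

Completes the `σ`-integration of R4 (STUB-PLAN memo attached to 23320).  For an unshifted source filament the distance to the complex target's real
foot satisfies `d(σ) ≥ a` (separation `ρ√Γ`, or the distance to the partner curve) and `d(σ) ≥ k|σ − σ*| − a` (linear escape,
`Theorems.NearStraightEscape`, `k = 7/8`); the pointwise kernel bound is `61/d(σ)²` (`Theorems.StadiumFarKernelBound`).  Here: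
* `sq_le_five_mul_sq` — `a ≤ d`, `k|u| − a ≤ d` ⇒ `k²u² + a² ≤ 5d²` (since `k|u| ≤ 2d`), hence `1/d² ≤ 5/(k²u² + a²)` (`inv_sq_le_lorentzian`):
  a smooth LORENTZIAN majorant, ready for `Literature.Analysis.Complex.HolomorphicParametricIntegral.differentiableOn_integral_of_dominated`;
* `integrable_lorentzian`, `integral_lorentzian` — `u ↦ (k²(u−σ*)² + a²)⁻¹` is integrable on `ℝ` with integral `π/(k·a)`.
So `∫_ℝ 61/d(σ)² dσ ≤ 305π/(k a)`; with `a ≥ ρ√Γ`, `k = 7/8` the far/partner part of the continued field is `O(Γθ₀⁻¹/(ρ√Γ)) = O(√Γ)`.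
HONEST FRAMING: a calculus brick for a plan about a HYPOTHETICAL filament skeleton on the NEGATIVE side of a MODEL route; the stub `stub_stripPropagation` is
NOT closed; nothing here bears on Navier–Stokes regularity or blow-up.  `--supports stmt-NavierStokesRegularity-23320`.
-/

set_option linter.dupNamespace false

noncomputable section

namespace Summit.NavierStokesRegularity.NavierStokesRegularity.Theorems.StadiumFarMajorant

open Set MeasureTheory

/-- `a ≤ d` and `k|u| − a ≤ d` give `k²u² + a² ≤ 5d²`. [folklore] -/
theorem sq_le_five_mul_sq {a k u d : ℝ} (hk : 0 ≤ k) (h1 : a ≤ d) (h2 : k * |u| - a ≤ d) :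
    k ^ 2 * u ^ 2 + a ^ 2 ≤ 5 * d ^ 2 := by
  have hku0 : 0 ≤ k * |u| := mul_nonneg hk (abs_nonneg u)
  have hku : k * |u| ≤ 2 * d := by linarith
  have h3 : (k * |u|) ^ 2 ≤ (2 * d) ^ 2 := pow_le_pow_left₀ hku0 hku 2
  have h4 : k ^ 2 * u ^ 2 = (k * |u|) ^ 2 := by rw [mul_pow, sq_abs]
  have hneg : -d ≤ a := by linarith
  have h5 : a ^ 2 ≤ d ^ 2 := sq_le_sq' hneg h1
  nlinarith [h3, h4, h5]

/-- **Lorentzian majorant.**  `0 < a ≤ d`, `k|u| − a ≤ d` (`k ≥ 0`) ⇒ `(d²)⁻¹ ≤ 5·(k²u² + a²)⁻¹`. [folklore] -/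
theorem inv_sq_le_lorentzian {a k u d : ℝ} (ha : 0 < a) (hk : 0 ≤ k) (h1 : a ≤ d) (h2 : k * |u| - a ≤ d) :
    (d ^ 2)⁻¹ ≤ 5 * (k ^ 2 * u ^ 2 + a ^ 2)⁻¹ := by
  have hd : 0 < d := ha.trans_le h1
  have hL : 0 < k ^ 2 * u ^ 2 + a ^ 2 := by positivity
  have h := sq_le_five_mul_sq hk h1 h2
  rw [← div_eq_mul_inv, inv_eq_one_div, div_le_div_iff₀ (by positivity) hL]
  linarith

/-- The Lorentzian `u ↦ (k²(u−σ*)² + a²)⁻¹` is integrable on `ℝ` (`a > 0`, `k ≠ 0`). [folklore] -/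
theorem integrable_lorentzian {a k : ℝ} (ha : 0 < a) (hk : k ≠ 0) (σ₀ : ℝ) :
    Integrable fun u : ℝ => (k ^ 2 * (u - σ₀) ^ 2 + a ^ 2)⁻¹ := by
  have h1 : Integrable fun u : ℝ => (1 + (k / a * u) ^ 2)⁻¹ :=
    integrable_inv_one_add_sq.comp_mul_left' (div_ne_zero hk ha.ne')
  have h2 : Integrable fun u : ℝ => (a ^ 2)⁻¹ * (1 + (k / a * u) ^ 2)⁻¹ := h1.const_mul _
  have h3 : (fun u : ℝ => (k ^ 2 * u ^ 2 + a ^ 2)⁻¹) = fun u : ℝ => (a ^ 2)⁻¹ * (1 + (k / a * u) ^ 2)⁻¹ := by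
    funext u
    rw [← mul_inv]
    congr 1
    field_simp
    ring
  have h4 : Integrable fun u : ℝ => (k ^ 2 * u ^ 2 + a ^ 2)⁻¹ := by rw [h3]; exact h2
  exact h4.comp_sub_right σ₀

/-- `∫_ℝ (k²(u−σ*)² + a²)⁻¹ du = π/(|k|·a)` (`a > 0`, `k ≠ 0`). [folklore] -/
theorem integral_lorentzian {a k : ℝ} (ha : 0 < a) (hk : k ≠ 0) (σ₀ : ℝ) :
    ∫ u : ℝ, (k ^ 2 * (u - σ₀) ^ 2 + a ^ 2)⁻¹ = Real.pi / (|k| * a) := by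
  rw [integral_sub_right_eq_self (fun u : ℝ => (k ^ 2 * u ^ 2 + a ^ 2)⁻¹) σ₀]
  have h3 : (fun u : ℝ => (k ^ 2 * u ^ 2 + a ^ 2)⁻¹) = fun u : ℝ => (a ^ 2)⁻¹ * (fun v : ℝ => (1 + v ^ 2)⁻¹) (k / a * u) := by
    funext u
    simp only
    rw [← mul_inv]
    congr 1
    field_simp
    ring
  rw [h3, integral_const_mul, Measure.integral_comp_mul_left (fun v : ℝ => (1 + v ^ 2)⁻¹) (k / a),
    integral_univ_inv_one_add_sq]
  rw [inv_div, abs_div, abs_of_pos ha, smul_eq_mul]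
  field_simp

/-- **The far majorant, assembled**: `C/d(σ)²` is dominated by the integrable `5C·(k²(σ−σ*)² + a²)⁻¹` whenever `d(σ) ≥ a > 0` and
`d(σ) ≥ k|σ − σ*| − a` (`k ≥ 0`, `C ≥ 0`). [folklore] -/
theorem far_majorant_le {a k C σ₀ σ : ℝ} {d : ℝ} (ha : 0 < a) (hk : 0 ≤ k) (hC : 0 ≤ C) (h1 : a ≤ d) (h2 : k * |σ - σ₀| - a ≤ d) :
    C / d ^ 2 ≤ 5 * C * (k ^ 2 * (σ - σ₀) ^ 2 + a ^ 2)⁻¹ := by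
  have h := inv_sq_le_lorentzian ha hk h1 h2
  calc C / d ^ 2 = C * (d ^ 2)⁻¹ := div_eq_mul_inv _ _
    _ ≤ C * (5 * (k ^ 2 * (σ - σ₀) ^ 2 + a ^ 2)⁻¹) := mul_le_mul_of_nonneg_left h hC
    _ = 5 * C * (k ^ 2 * (σ - σ₀) ^ 2 + a ^ 2)⁻¹ := by ring

end Summit.NavierStokesRegularity.NavierStokesRegularity.Theorems.StadiumFarMajorant

end
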